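import Literature.Analysis.FluidPDE.QuasiSelfSimilarCellwiseStage
import HarnessLib

/-!
# The cellwise stage along a snake table; conservation through a sealed cell move

Topic `Literature/Analysis/FluidPDE`. Sequel of `QuasiSelfSimilarCellwiseStage.lean` (consumer
end of the kinematic leaf `acm_compatible_blocks`). Two book-keeping statements:

* `IsCellFamily.of_table` — when the gates of the `25` cell moves are those of the children of a
  generator `g` in a snake table (`QuasiSelfSimilar.childGate childGen childSym g p`,
  `QuasiSelfSimilar.IsSnakeTable`, ACM 2019, §8.1 (e)), the three gate-matching hypotheses of
  `IsCellFamily.of_moves` ARE the three clauses of the snake table, so only the window fields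
  remain to be matched;
* `IsCellMove.setIntegral_comp_eq` — a cell move whose window velocities are tangent to their
  faces is sealed (tangent to `∂[0,1]²`), hence (Liouville/Reynolds,
  `BoxTransportConservation.lean`) `∫_{[0,1)²} Φ(Θ(t,·))` is constant on a time interval
  `[a, b] ⊆ S` (ACM 2019, Rem. 24 (iv)). Use: the fine move of the straight generator (ACM Fig. 11,
  left) takes the plain straight channel to the initial state `Γ₁(0)` of the straight generator;
  its zero average and unit mass at `t = 0` (`IsGeneratorBlock.zeroMean_zero`, `unitL2_zero`)
  are therefore those of a straight tile (`QuasiSelfSimilarChannelProfile.lean`), with no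
  integral over the meander to compute;
* `selfSimilar_of_cellwise_end` — the self-similarity hypothesis `hS` of
  `acm_compatible_blocks_of_generators` read off the end states of the cells of the cellwise
  stage (ACM §8.1 (e)): per cell, the end state is the placed initial state of the child.

## References

* G. Alberti, G. Crippa, A. L. Mazzucato, *Exponential self-similar mixing by incompressible
  flows*, J. Amer. Math. Soc. 32 (2019), 445–490, §8.1 (e), Rem. 24 (iv), §8.10–8.11, Fig. 11
  (arXiv:1605.02090).
-/

noncomputable section

open Set Filter Function MeasureTheory

open scoped Topology ContDiff

namespace Literature.Analysis.FluidPDE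

namespace QuasiSelfSimilar

open FunctionSpaces FunctionSpaces.Torus

/-- The plane. [folklore] -/
local notation "E²" => EuclideanSpace ℝ (Fin 2)

/-! ## Cell families along a snake table -/

section Table

variable {S : Set ℝ} {Vc : (Fin 2 → Fin 5) → ℝ → E² → E²} {Θc : (Fin 2 → Fin 5) → ℝ → E² → ℝ}
  {Wvc : (Fin 2 → Fin 5) → Fin 2 → Bool → ℝ → E² → E²} {Wθc : (Fin 2 → Fin 5) → Fin 2 → Bool → ℝ → E² → ℝ}
  {Wv : Fin 2 → ℝ → E² → E²} {Wθ : Fin 2 → ℝ → E² → ℝ} {δ : ℝ}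
  {childGen : Gen → (Fin 2 → Fin 5) → Gen} {childSym : Gen → (Fin 2 → Fin 5) → SymmCode}

/-- **Cell families along a snake table** (ACM 2019, §8.1 (e) with §8.10–8.11): if the cell move
in the subsquare `p` of the generator `g` has the gates of the child placed there by a snake
table (`childGate childGen childSym g p`), then the gate-matching hypotheses of
`IsCellFamily.of_moves` (interior interfaces, outer sides) are the clauses `internal`,
`boundary_lo`, `boundary_hi` of `IsSnakeTable`; given matching window fields across the interior
interfaces and the universal window fields at the outer gates, the `25` cell moves form a cell
family for the gates `genGate g` of the generator. [cite: AlbertiCrippaMazzucato2019, §8.1 (e)] -/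
theorem IsCellFamily.of_table (hT : IsSnakeTable childGen childSym) (g : Gen) (hδ : 0 < δ) (hδ1 : δ ≤ 8⁻¹)
    (hmove : ∀ p, IsCellMove S (Vc p) (Θc p) (childGate childGen childSym g p) (Wvc p) (Wθc p) δ)
    (hWv : ∀ k, ContDiff ℝ ∞ (uncurry (Wv k))) (hWθ : ∀ k, ContDiff ℝ ∞ (uncurry (Wθ k)))
    (hWtan : ∀ (k : Fin 2) (t : ℝ) (ζ : E²), ζ k = 0 → Wv k t ζ k = 0)
    (hWvan : ∀ (k : Fin 2) (t : ℝ) (ζ : E²), (∃ j, j ≠ k ∧ δ ≤ |ζ j|) → Wv k t ζ = 0 ∧ Wθ k t ζ = 0)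
    (hint_W : ∀ (p : Fin 2 → Fin 5) (k : Fin 2) (h : (p k : ℕ) + 1 < 5),
      childGate childGen childSym g p k true = true →
        Wvc p k true = Wvc (update p k ⟨(p k : ℕ) + 1, h⟩) k false ∧
          Wθc p k true = Wθc (update p k ⟨(p k : ℕ) + 1, h⟩) k false)
    (hlo_W : ∀ (p : Fin 2 → Fin 5) (k : Fin 2), (p k : ℕ) = 0 → childGate childGen childSym g p k false = true →
      Wvc p k false = Wv k ∧ Wθc p k false = Wθ k)
    (hhi_W : ∀ (p : Fin 2 → Fin 5) (k : Fin 2), (p k : ℕ) = 4 → childGate childGen childSym g p k true = true →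
      Wvc p k true = Wv k ∧ Wθc p k true = Wθ k) :
    IsCellFamily S Vc Θc (genGate g) Wv Wθ δ :=
  IsCellFamily.of_moves hδ hδ1 hmove hWv hWθ hWtan hWvan (fun p k h => hT.internal g p k h) hint_W
    (fun p k hp => hT.boundary_lo g p k hp) hlo_W (fun p k hp => hT.boundary_hi g p k hp) hhi_W

end Table

/-! ## Conservation through a sealed cell move -/

section Sealed

variable {S : Set ℝ} {V : ℝ → E² → E²} {Θ : ℝ → E² → ℝ} {gate : Fin 2 → Bool → Bool}
  {Wv : Fin 2 → Bool → ℝ → E² → E²} {Wθ : Fin 2 → Bool → ℝ → E² → ℝ} {δ : ℝ}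

/-- **A cell move with tangent window velocities is tangent to the boundary of its square** (on
the faces the velocity is the window velocity or zero). [folklore] -/
theorem IsCellMove.tangent (h : IsCellMove S V Θ gate Wv Wθ δ) (hδ : 0 < δ)
    (hWtan : ∀ (k : Fin 2) (s : Bool) (t : ℝ) (ζ : E²), ζ k = 0 → Wv k s t ζ k = 0)
    (t : ℝ) {z : E²} (j : Fin 2) (hj : z j = 0 ∨ z j = 1) : V t z j = 0 := by
  rcases hj with hj | hj
  · have hs : |z j - faceValue false| < δ := by rw [faceValue_false, hj, sub_zero, abs_zero]; exact hδ
    rw [(h.of_strip hs t).1]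
    split_ifs
    · exact hWtan j false t _ (by rw [PiLp.sub_apply, faceMidpoint_apply, if_pos rfl, hj, faceValue_false, sub_zero])
    · rfl
  · have hs : |z j - faceValue true| < δ := by rw [faceValue_true, hj, sub_self, abs_zero]; exact hδ
    rw [(h.of_strip hs t).1]
    split_ifs
    · exact hWtan j true t _ (by rw [PiLp.sub_apply, faceMidpoint_apply, if_pos rfl, hj, faceValue_true, sub_self])
    · rfl

/-- **Conservation through a sealed cell move** (ACM 2019, Rem. 24 (iv); Liouville/Reynolds on
the square, `BoxTransport.setIntegral_unitCube_comp_eq_of_transport`): if the window velocities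
are tangent to their faces and `[a, b] ⊆ S`, then for every `C¹` function `Φ` and `t ∈ [a, b]`,
`∫_{[0,1)²} Φ(Θ(t,·)) = ∫_{[0,1)²} Φ(Θ(a,·))`. In particular the end state of the fine move of
the straight generator has the average and the mass of the plain straight channel it starts
from. [cite: AlbertiCrippaMazzucato2019, Remark 24 (iv)] -/
theorem IsCellMove.setIntegral_comp_eq (h : IsCellMove S V Θ gate Wv Wθ δ) (hδ : 0 < δ)
    (hWtan : ∀ (k : Fin 2) (s : Bool) (t : ℝ) (ζ : E²), ζ k = 0 → Wv k s t ζ k = 0)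
    {a b : ℝ} (hab : Icc a b ⊆ S) {Φ : ℝ → ℝ} (hΦ : ContDiff ℝ 1 Φ) {t : ℝ} (ht : t ∈ Icc a b) :
    ∫ z in unitCube (Fin 2), Φ (Θ t z) = ∫ z in unitCube (Fin 2), Φ (Θ a z) :=
  BoxTransport.setIntegral_unitCube_comp_eq_of_transport (n := 1) (V := V) (Θ := Θ) (a := a) (b := b) hΦ
    (h.smooth_velocity.of_le ENat.LEInfty.out) (h.smooth_scalar.of_le ENat.LEInfty.out)
    (fun s hs z hz => h.divFree s (hab hs) z hz)
    (fun s _ _ _ j hj => h.tangent hδ hWtan s j hj) (fun s hs z hz => h.transport s (hab hs) z hz) ht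

/-- **Zero average and unit mass of the end state** of a sealed cell move on `[a, b] ⊆ S` whose
initial state has them (the case `Φ = id`, `Φ = (·)²`). [cite: AlbertiCrippaMazzucato2019, Remark 24 (iv)] -/
theorem IsCellMove.moments_end_of_start (h : IsCellMove S V Θ gate Wv Wθ δ) (hδ : 0 < δ)
    (hWtan : ∀ (k : Fin 2) (s : Bool) (t : ℝ) (ζ : E²), ζ k = 0 → Wv k s t ζ k = 0)
    {a b : ℝ} (hab : a ≤ b) (hS : Icc a b ⊆ S)
    (h0 : ∫ z in unitCube (Fin 2), Θ a z = 0) (h1 : ∫ z in unitCube (Fin 2), Θ a z ^ 2 = 1) :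
    (∫ z in unitCube (Fin 2), Θ b z = 0) ∧ ∫ z in unitCube (Fin 2), Θ b z ^ 2 = 1 := by
  have hb : b ∈ Icc a b := ⟨hab, le_rfl⟩
  constructor
  · have := h.setIntegral_comp_eq hδ hWtan hS (Φ := id) contDiff_id hb
    simpa using this.trans h0
  · have := h.setIntegral_comp_eq hδ hWtan hS (Φ := fun x => x ^ 2) (contDiff_id.pow 2) hb
    exact this.trans h1

end Sealed

/-! ## The self-similarity clause from the end states of the cells -/

section EndState

variable {Θc : (Fin 2 → Fin 5) → ℝ → E² → ℝ} {gate : Fin 2 → Bool → Bool} {Wθ : Fin 2 → ℝ → E² → ℝ} {δ : ℝ}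
  {Θ₀ : Gen → ℝ → E² → ℝ} {childGen : Gen → (Fin 2 → Fin 5) → Gen} {childSym : Gen → (Fin 2 → Fin 5) → SymmCode}

/-- **Self-similarity from the end states of the cells** (ACM 2019, §8.1 (e)): if the generator
`g` ends, at `t = 1`, as the glued scalar of a cellwise stage whose cell `p` ends as the placed
initial state `(σ • Θ_{g'})(0, ·)`, `(g', σ) = (childGen g p, childSym g p)`, on the open unit
square, then `g` satisfies the self-similarity hypothesis `hS` of
`acm_compatible_blocks_of_generators` / `…_of_generator_moves`. [cite: AlbertiCrippaMazzucato2019, §8.1 (e)] -/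
theorem selfSimilar_of_cellwise_end (g : Gen)
    (hend : ∀ z, Θ₀ g 1 z = cellwiseΘ Θc gate Wθ δ 1 z)
    (hcell : ∀ (p : Fin 2 → Fin 5) (w : E²), (∀ k, w k ∈ Ioo (0 : ℝ) 1) →
      Θc p 1 w = (childSym g p).toSymm.actScalar (Θ₀ (childGen g p)) 0 w)
    (p : Fin 2 → Fin 5) {z : E²} (hz : z ∈ latticeCellInterior 5 (fun k => ((p k : ℕ) : ℤ))) :
    Θ₀ g 1 z = (childSym g p).toSymm.actScalar (Θ₀ (childGen g p)) 0
      ((5 : ℝ) • z - latticeVec (fun k => ((p k : ℕ) : ℤ))) := by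
  have hz' : z ∈ latticeCellInterior 5 (cidx p) := hz
  rw [hend z, IsCellFamily.cellwiseΘ_apply_of_mem_latticeCellInterior p hz' 1]
  refine hcell p _ fun k => ?_
  obtain ⟨h1, h2⟩ := hz k
  simp only [Nat.cast_ofNat, Int.cast_natCast] at h1 h2
  rw [PiLp.sub_apply, PiLp.smul_apply, latticeVec_apply, cidx_apply, smul_eq_mul, Int.cast_natCast]
  constructor
  · have := (div_lt_iff₀ (by norm_num : (0 : ℝ) < 5)).1 h1; linarith
  · have := (lt_div_iff₀ (by norm_num : (0 : ℝ) < 5)).1 h2; linarith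

end EndState

end QuasiSelfSimilar

end Literature.Analysis.FluidPDE
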